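import Summits.ValiantsHypothesis.ValiantsHypothesis.Theorems.PolyaContinuedLaplaceRigiditySingKCoreLemmaA
import Summits.ValiantsHypothesis.ValiantsHypothesis.Theorems.PolyaContinuedLaplaceRigiditySingKCoreKernel

/-!
# Top-dimensional components of `Sing(per₄)` with exactly one zero line, part 2: the kernel line
# (the «K-core» of stub B-row of line `component_rigidity`, generic-point half)

Helper file for crux `CoverDecancellation` (stmt-ValiantsHypothesis-17819), line `laplace_rigidity`,
rung row R3 at width 4 (`str₂(per₄) ≥ 5`), read against val-idea-10 g3's line «component_rigidity»
(workfile v4, registered stub `stub_rowPrimeRigidity`).  Setting (the «K-core»): a prime `P` of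
`F[X_{4×4}]` over the `3 × 3` sub-permanents, of height `≤ 8`, containing the four variables of row
`i`, and such that none of the other rows `j, k, l` and no column has all its variables in `P`; and a
point `z` over a field `L ⊇ F` with `ker (f ↦ f(z)) = P` (the generic point,
`…SingGenericPoint.ker_aeval_quotient_mk_X`).  Write `u = z_j, v = z_k, r = z_l` and
`w_ab = u_a v_b + u_b v_a`.

Inputs from part 2a (`…SingKCoreKernel`): the equations `M(u,v) · r = 0` (T1), `8 ≤ trdeg_F F[z]`
(T3), and the Schur elimination at a pivot; from part 1 (`…SingKCoreLemmaA`): LEMMA A.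

* **`trdeg_le_trdeg_rows_add_one`** (T5, THE KERNEL LINE) — in the K-core,
  `trdeg_F F[z] ≤ trdeg_F F[u,v] + 1` (`2 ≠ 0` in `F`).  Proof: at a pivot, `A ≠ 0` or `C ≠ 0` puts
  `r` on a line over `F(u,v)`; `A = C = 0 ≠ B` forces `r = 0` (row `l` in `P`); `A = B = C = 0` is
  LEMMA A's star/matching locus (`…SingKCoreLemmaA`: `trdeg_F F[u,v] ≤ 5`, so `trdeg_F F[z] ≤ 7 < 8`);
  no pivot at all is `M(u,v) = 0` (`trdeg ≤ 3 + 4`).  A zero column of `[u;v]` is excluded inside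
  the proof (it would force the corresponding `r`-coordinate, hence the whole column, into `P`).

Part 3 (`…SingKCorePoint`) adds the octic `det M(u,v) = 0` and the non-vanishing of coordinates and
binomials at the generic point.  Honest framing: structure lemmas; `str₂(per₄) ≥ 5`,
`StrengthTwoPerFour` (stmt-25160), `CentralLaplaceRigidity`, `CoverDecancellation`, VP ≠ VNP are OPEN
and NOT moved; no summit statement is touched.  val-width-17819-w1 g2, 2026-08-28.

References: G. Kirkup, Trans. AMS 360 (2008), Prop. 11 / Thm. 14 [Kirkup2005]; A. Boralevi,
E. Carlini, M. Michałek, E. Ventura, Adv. Math. 461 (2025), Prop. 3.10 [BoraleviCarliniMichalekVentura2025].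
-/

set_option linter.dupNamespace false

noncomputable section

namespace Summit.ValiantsHypothesis.ValiantsHypothesis.Theorems.PolyaContinuedLaplaceRigidity.SingCodim

open MvPolynomial Cardinal
open Summit.ValiantsHypothesis.ValiantsHypothesis.Theorems.SymPencilPerFourHessianRankThreeZero (eq_or_of_four)
open Literature.Computability.AlgebraicComplexity
open Literature.Computability.AlgebraicComplexity.BoraleviCarliniMichalekVentura2025

variable {F : Type*} [Field F] {L : Type*} [Field L] [Algebra F L]

/-! ### T5: the kernel line -/

/-- **T5 — THE KERNEL LINE.**  In the K-core (prime `P ⊇ subpermIdeal F 4 4 3` of height `≤ 8`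
containing row `i`, with rows `j, k, l` and all columns NOT contained in `P`), at a point `z` with
kernel `P`: `trdeg_F F[z] ≤ trdeg_F F[z_j, z_k] + 1` (`2 ≠ 0` in `F`).  See the module docstring for
the case analysis (pivot / Schur system / LEMMA A). [cite: Kirkup2005, Prop. 11] -/
theorem trdeg_le_trdeg_rows_add_one (h2 : (2 : F) ≠ 0)
    {P : Ideal (MvPolynomial (Fin 4 × Fin 4) F)} [P.IsPrime]
    (hle : subpermIdeal F 4 4 3 ≤ P) (h8 : P.height ≤ 8) {i j k l : Fin 4} (hij : i ≠ j) (hik : i ≠ k)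
    (hil : i ≠ l) (hjk : j ≠ k) (hjl : j ≠ l) (hkl : k ≠ l)
    (hrow : ∀ c, (X (i, c) : MvPolynomial (Fin 4 × Fin 4) F) ∈ P)
    (hj : ∃ c, (X (j, c) : MvPolynomial (Fin 4 × Fin 4) F) ∉ P)
    (hk : ∃ c, (X (k, c) : MvPolynomial (Fin 4 × Fin 4) F) ∉ P)
    (hl : ∃ c, (X (l, c) : MvPolynomial (Fin 4 × Fin 4) F) ∉ P)
    (hcol : ∀ c, ∃ ρ, (X (ρ, c) : MvPolynomial (Fin 4 × Fin 4) F) ∉ P)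
    (z : Fin 4 × Fin 4 → L) (hker : RingHom.ker (aeval (R := F) z) = P) :
    Algebra.trdeg F (Algebra.adjoin F (Set.range z)) ≤
      Algebra.trdeg F (Algebra.adjoin F
        (Set.range (fun c => z (j, c)) ∪ Set.range (fun c => z (k, c)))) + 1 := by
  classical
  have h2L : (2 : L) ≠ 0 := by
    intro h
    apply h2
    apply (algebraMap F L).injective
    rw [map_ofNat, map_zero, h]
  -- rows and the six `2 × 2` permanents
  set u : Fin 4 → L := fun c => z (j, c) with hu
  set v : Fin 4 → L := fun c => z (k, c) with hv
  set r : Fin 4 → L := fun c => z (l, c) with hr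
  set S : Set L := Set.range u ∪ Set.range v with hS
  have hz0 : ∀ e, (X e : MvPolynomial (Fin 4 × Fin 4) F) ∈ P ↔ z e = 0 := X_mem_iff_eq_zero z hker
  have hrow0 : ∀ c, z (i, c) = 0 := fun c => (hz0 _).1 (hrow c)
  have hu0 : ∃ c, u c ≠ 0 := by
    obtain ⟨c, hc⟩ := hj; exact ⟨c, fun h => hc ((hz0 _).2 h)⟩
  have hv0 : ∃ c, v c ≠ 0 := by
    obtain ⟨c, hc⟩ := hk; exact ⟨c, fun h => hc ((hz0 _).2 h)⟩
  have hr0 : ∃ c, r c ≠ 0 := by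
    obtain ⟨c, hc⟩ := hl; exact ⟨c, fun h => hc ((hz0 _).2 h)⟩
  -- no zero column among the three rows
  have hcol3 : ∀ c, u c ≠ 0 ∨ v c ≠ 0 ∨ r c ≠ 0 := by
    intro c
    obtain ⟨ρ, hρ⟩ := hcol c
    have hρ0 : z (ρ, c) ≠ 0 := fun h => hρ ((hz0 _).2 h)
    rcases eq_or_of_four i j k l hij hik hil hjk hjl hkl ρ with rfl | rfl | rfl | rfl
    · exact absurd (hrow0 c) hρ0
    · exact Or.inl hρ0
    · exact Or.inr (Or.inl hρ0)
    · exact Or.inr (Or.inr hρ0)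
  -- the kernel equations `M(u,v) r = 0`
  have hT1 : ∀ c₀ c₁ c₂ : Fin 4, c₀ ≠ c₁ → c₀ ≠ c₂ → c₁ ≠ c₂ →
      (u c₀ * v c₁ + u c₁ * v c₀) * r c₂ + (u c₀ * v c₂ + u c₂ * v c₀) * r c₁ +
        (u c₁ * v c₂ + u c₂ * v c₁) * r c₀ = 0 := fun c₀ c₁ c₂ k₀₁ k₀₂ k₁₂ =>
    subperm_rows_eq_zero hle z hker hjk hjl hkl k₀₁ k₀₂ k₁₂
  -- every coordinate of `z` is zero or a coordinate of `u, v, r`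
  have hcoord : ∀ e : Fin 4 × Fin 4,
      z e = 0 ∨ z e ∈ S ∨ z e ∈ Set.range r := by
    rintro ⟨ρ, c⟩
    rcases eq_or_of_four i j k l hij hik hil hjk hjl hkl ρ with rfl | rfl | rfl | rfl
    · exact Or.inl (hrow0 c)
    · exact Or.inr (Or.inl (Or.inl ⟨c, rfl⟩))
    · exact Or.inr (Or.inl (Or.inr ⟨c, rfl⟩))
    · exact Or.inr (Or.inr ⟨c, rfl⟩)
  -- trdeg lower bound
  have h8z := eight_le_trdeg h8 z hker
  -- contradiction device: `trdeg_F F[u,v] ≤ mS` and `r` covered by `g : Fin kk → L` with `mS + kk ≤ 7`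
  have absurd_of_cover : ∀ {mS kk : ℕ} (g : Fin kk → L),
      Algebra.trdeg F (Algebra.adjoin F S) ≤ mS → mS + kk ≤ 7 →
      (∀ c, IsAlgebraic (Algebra.adjoin F (S ∪ Set.range g)) (r c)) → False := by
    intro mS kk g hmS hsum hg
    have hcov := trdeg_adjoin_le_of_cover_add (F := F) (U := Set.range z) hmS g fun x hx => ?_
    · have h7 : Algebra.trdeg F (Algebra.adjoin F (Set.range z)) ≤ (7 : ℕ) :=
        hcov.trans (by exact_mod_cast hsum)
      have := h8z.trans h7
      norm_num at this
    · obtain ⟨e, rfl⟩ := hx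
      rcases hcoord e with h0 | hSe | ⟨c, hc⟩
      · exact alg_of_eq_zero _ h0
      · exact alg_of_mem (Or.inl hSe)
      · rw [← hc]; exact hg c
  -- Case A: all six `w` vanish
  by_cases hM : ∀ a b : Fin 4, a ≠ b → u a * v b + u b * v a = 0
  · exfalso
    refine absurd_of_cover (mS := 3) (kk := 4) r
      (trdeg_le_three_of_perTwo_all (F := F) u v h2L hM hu0 hv0) (by norm_num) fun c => ?_
    exact alg_of_mem (Or.inr ⟨c, rfl⟩)
  -- Case B: a pivot `w e f ≠ 0`
  push Not at hM
  obtain ⟨e, f, hef, hm⟩ := hM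
  obtain ⟨c, d, hcd, hce, hcf, hde, hdf⟩ := exists_two_others e f hef
  have four : ∀ x : Fin 4, x = c ∨ x = d ∨ x = e ∨ x = f :=
    eq_or_of_four c d e f hcd hce hcf hde hdf hef
  -- names for the six permanents
  set m := u e * v f + u f * v e with hmdef
  set p := u d * v f + u f * v d with hpdef
  set q := u d * v e + u e * v d with hqdef
  set s := u c * v f + u f * v c with hsdef
  set t := u c * v e + u e * v c with htdef
  set n := u c * v d + u d * v c with hndef
  -- the four equations in pivot form
  have hEc : m * r d + p * r e + q * r f = 0 := by
    linear_combination hT1 d e f hde hdf hef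
  have hEd : m * r c + s * r e + t * r f = 0 := by
    linear_combination hT1 c e f hce hcf hef
  have hEe : p * r c + s * r d + n * r f = 0 := by
    linear_combination hT1 c d f hcd hcf hdf
  have hEf : q * r c + t * r d + n * r e = 0 := by
    linear_combination hT1 c d e hcd hce hde
  obtain ⟨hrc, hrd⟩ := kernel_solve hEc hEd
  obtain ⟨hA, hB⟩ := kernel_schur hEc hEd hEe hEf
  -- memberships in `F[S]`
  have huS : ∀ x, u x ∈ Algebra.adjoin F S := fun x => Algebra.subset_adjoin (Or.inl ⟨x, rfl⟩)
  have hvS : ∀ x, v x ∈ Algebra.adjoin F S := fun x => Algebra.subset_adjoin (Or.inr ⟨x, rfl⟩)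
  have hwS : ∀ a b, u a * v b + u b * v a ∈ Algebra.adjoin F S := fun a b =>
    Subalgebra.add_mem _ (Subalgebra.mul_mem _ (huS a) (hvS b))
      (Subalgebra.mul_mem _ (huS b) (hvS a))
  have hST : ∀ T : Set L, S ⊆ T → ∀ a b, u a * v b + u b * v a ∈ Algebra.adjoin F T :=
    fun T hT a b => Algebra.adjoin_mono hT (hwS a b)
  -- `r_c, r_d` are algebraic over `F[S, r_e, r_f]`
  have hReRf : S ⊆ S ∪ Set.range ![r e, r f] := Set.subset_union_left
  have hre_mem : r e ∈ Algebra.adjoin F (S ∪ Set.range ![r e, r f]) :=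
    Algebra.subset_adjoin (Or.inr ⟨0, by simp⟩)
  have hrf_mem : r f ∈ Algebra.adjoin F (S ∪ Set.range ![r e, r f]) :=
    Algebra.subset_adjoin (Or.inr ⟨1, by simp⟩)
  have hrc_alg : IsAlgebraic (Algebra.adjoin F (S ∪ Set.range ![r e, r f])) (r c) :=
    alg_of_mul_eq (c := m) (d := -(s * r e + t * r f)) (hST _ hReRf e f)
      (Subalgebra.neg_mem _ (Subalgebra.add_mem _ (Subalgebra.mul_mem _ (hST _ hReRf c f) hre_mem)
        (Subalgebra.mul_mem _ (hST _ hReRf c e) hrf_mem))) hm (by rw [mul_comm]; exact hrc)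
  have hrd_alg : IsAlgebraic (Algebra.adjoin F (S ∪ Set.range ![r e, r f])) (r d) :=
    alg_of_mul_eq (c := m) (d := -(p * r e + q * r f)) (hST _ hReRf e f)
      (Subalgebra.neg_mem _ (Subalgebra.add_mem _ (Subalgebra.mul_mem _ (hST _ hReRf d f) hre_mem)
        (Subalgebra.mul_mem _ (hST _ hReRf d e) hrf_mem))) hm (by rw [mul_comm]; exact hrd)
  have hr_alg2 : ∀ x, IsAlgebraic (Algebra.adjoin F (S ∪ Set.range ![r e, r f])) (r x) := by
    intro x
    rcases four x with rfl | rfl | rfl | rfl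
    · exact hrc_alg
    · exact hrd_alg
    · exact alg_of_mem (Or.inr ⟨0, by simp⟩)
    · exact alg_of_mem (Or.inr ⟨1, by simp⟩)
  -- no column of `[u; v]` vanishes (else the pivot equations force the whole column into `P`)
  have hcol2 : ∀ x, u x ≠ 0 ∨ v x ≠ 0 := by
    intro x
    by_contra hx
    push Not at hx
    obtain ⟨hux, hvx⟩ := hx
    have hw0 : ∀ y, u x * v y + u y * v x = 0 := fun y => by rw [hux, hvx]; ring
    rcases four x with rfl | rfl | rfl | rfl
    · -- `x = c`: `s = t = 0`, so `m r_c = 0`, column `c` in `P`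
      have hs0 : s = 0 := hw0 f
      have ht0 : t = 0 := hw0 e
      have hrc0 : r x = 0 := by
        have : r x * m = 0 := by rw [hrc, hs0, ht0]; ring
        rcases mul_eq_zero.1 this with h | h
        · exact h
        · exact absurd h hm
      rcases hcol3 x with h | h | h
      · exact h hux
      · exact h hvx
      · exact h hrc0
    · have hp0 : p = 0 := hw0 f
      have hq0 : q = 0 := hw0 e
      have hrd0 : r x = 0 := by
        have : r x * m = 0 := by rw [hrd, hp0, hq0]; ring
        rcases mul_eq_zero.1 this with h | h
        · exact h
        · exact absurd h hm
      rcases hcol3 x with h | h | h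
      · exact h hux
      · exact h hvx
      · exact h hrd0
    · exact hm (by rw [hmdef, hux, hvx]; ring)
    · exact hm (by rw [hmdef, hux, hvx]; ring)
  -- the line conclusion from one more algebraic `r`-coordinate
  have line_of : ∀ (a b : Fin 4), (a = e ∧ b = f ∨ a = f ∧ b = e) →
      IsAlgebraic (Algebra.adjoin F (S ∪ {r b})) (r a) →
      Algebra.trdeg F (Algebra.adjoin F (Set.range z)) ≤
        Algebra.trdeg F (Algebra.adjoin F S) + 1 := by
    intro a b hab ha
    have hsub : S ⊆ S ∪ {r b} := Set.subset_union_left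
    have hall : ∀ y ∈ S ∪ Set.range ![r e, r f],
        IsAlgebraic (Algebra.adjoin F (S ∪ {r b})) y := by
      rintro y (hy | ⟨t', rfl⟩)
      · exact alg_of_mem (hsub hy)
      · fin_cases t'
        · rcases hab with ⟨rfl, rfl⟩ | ⟨rfl, rfl⟩
          · simpa using ha
          · simpa using (alg_of_mem (Or.inr rfl) :
              IsAlgebraic (Algebra.adjoin F (S ∪ {r b})) (r b))
        · rcases hab with ⟨rfl, rfl⟩ | ⟨rfl, rfl⟩
          · simpa using (alg_of_mem (Or.inr rfl) :
              IsAlgebraic (Algebra.adjoin F (S ∪ {r b})) (r b))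
          · simpa using ha
    refine le_trans (trdeg_adjoin_le_trdeg_of_forall_alg fun x hx => ?_)
      (trdeg_adjoin_union_singleton_le S (r b))
    obtain ⟨e', rfl⟩ := hx
    rcases hcoord e' with h0 | hSe | ⟨x', hx'⟩
    · exact alg_of_eq_zero _ h0
    · exact alg_of_mem (hsub hSe)
    · rw [← hx']
      exact alg_trans (hr_alg2 x') hall
  -- Case B1: `A ≠ 0` — `r_e` is determined by `r_f`
  by_cases hA0 : 2 * p * s = 0
  swap
  · refine line_of e f (Or.inl ⟨rfl, rfl⟩) ?_
    refine alg_of_mul_eq (c := -(2 * p * s)) (d := -((m * n - p * t - s * q) * r f))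
      (Subalgebra.neg_mem _ (Subalgebra.mul_mem _ (Subalgebra.mul_mem _ (by
        exact Subalgebra.natCast_mem _ 2) (hST _ Set.subset_union_left d f))
        (hST _ Set.subset_union_left c f))) ?_ (neg_ne_zero.2 hA0) ?_
    · refine Subalgebra.neg_mem _ (Subalgebra.mul_mem _ ?_ (Algebra.subset_adjoin (Or.inr rfl)))
      exact Subalgebra.sub_mem _ (Subalgebra.sub_mem _
        (Subalgebra.mul_mem _ (hST _ Set.subset_union_left e f) (hST _ Set.subset_union_left c d))
        (Subalgebra.mul_mem _ (hST _ Set.subset_union_left d f) (hST _ Set.subset_union_left c e)))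
        (Subalgebra.mul_mem _ (hST _ Set.subset_union_left c f) (hST _ Set.subset_union_left d e))
    · linear_combination hA
  -- Case B2: `C ≠ 0` — `r_f` is determined by `r_e`
  by_cases hC0 : 2 * q * t = 0
  swap
  · refine line_of f e (Or.inr ⟨rfl, rfl⟩) ?_
    refine alg_of_mul_eq (c := -(2 * q * t)) (d := -((m * n - p * t - s * q) * r e))
      (Subalgebra.neg_mem _ (Subalgebra.mul_mem _ (Subalgebra.mul_mem _ (by
        exact Subalgebra.natCast_mem _ 2) (hST _ Set.subset_union_left d e))
        (hST _ Set.subset_union_left c e))) ?_ (neg_ne_zero.2 hC0) ?_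
    · refine Subalgebra.neg_mem _ (Subalgebra.mul_mem _ ?_ (Algebra.subset_adjoin (Or.inr rfl)))
      exact Subalgebra.sub_mem _ (Subalgebra.sub_mem _
        (Subalgebra.mul_mem _ (hST _ Set.subset_union_left e f) (hST _ Set.subset_union_left c d))
        (Subalgebra.mul_mem _ (hST _ Set.subset_union_left d f) (hST _ Set.subset_union_left c e)))
        (Subalgebra.mul_mem _ (hST _ Set.subset_union_left c f) (hST _ Set.subset_union_left d e))
    · linear_combination hB
  -- Case B3: `A = C = 0`
  by_cases hB0 : m * n - p * t - s * q = 0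
  swap
  · -- `B ≠ 0`: `r_e = r_f = 0`, hence `r = 0` — row `l` would lie in `P`
    exfalso
    have hrf0 : r f = 0 := by
      have : (m * n - p * t - s * q) * r f = 0 := by
        have := hA; rw [show -(2 * p * s) = 0 by rw [hA0, neg_zero], zero_mul, zero_add] at this
        exact this
      rcases mul_eq_zero.1 this with h | h
      · exact absurd h hB0
      · exact h
    have hre0 : r e = 0 := by
      have : (m * n - p * t - s * q) * r e = 0 := by
        have := hB; rw [show -(2 * q * t) = 0 by rw [hC0, neg_zero], zero_mul, add_zero] at this
        exact this
      rcases mul_eq_zero.1 this with h | h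
      · exact absurd h hB0
      · exact h
    have hrc0 : r c = 0 := by
      have : r c * m = 0 := by rw [hrc, hre0, hrf0]; ring
      rcases mul_eq_zero.1 this with h | h
      · exact h
      · exact absurd h hm
    have hrd0 : r d = 0 := by
      have : r d * m = 0 := by rw [hrd, hre0, hrf0]; ring
      rcases mul_eq_zero.1 this with h | h
      · exact h
      · exact absurd h hm
    obtain ⟨x, hx⟩ := hr0
    rcases four x with rfl | rfl | rfl | rfl
    · exact hx hrc0
    · exact hx hrd0
    · exact hx hre0
    · exact hx hrf0
  -- Case B4: `A = B = C = 0` — LEMMA A (star or matching), `trdeg ≤ 5 + 2`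
  exfalso
  have hps : p = 0 ∨ s = 0 := by
    rcases mul_eq_zero.1 hA0 with h | h
    · rcases mul_eq_zero.1 h with h' | h'
      · exact absurd h' h2L
      · exact Or.inl h'
    · exact Or.inr h
  have hqt : q = 0 ∨ t = 0 := by
    rcases mul_eq_zero.1 hC0 with h | h
    · rcases mul_eq_zero.1 h with h' | h'
      · exact absurd h' h2L
      · exact Or.inl h'
    · exact Or.inr h
  have hwsymm : ∀ a b, u a * v b + u b * v a = u b * v a + u a * v b := fun a b => by ring
  refine absurd_of_cover (mS := 5) (kk := 2) ![r e, r f] ?_ (by norm_num) hr_alg2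
  rcases hps with hp0 | hs0 <;> rcases hqt with hq0 | ht0
  · -- `p = q = 0`, then `n = 0`: STAR at `d`
    have hn0 : n = 0 := by
      have : m * n = 0 := by linear_combination hB0 + t * hp0 + s * hq0
      rcases mul_eq_zero.1 this with h | h
      · exact absurd h hm
      · exact h
    refine trdeg_le_five_of_star (F := F) u v d (fun x hx => ?_) (hcol2 d)
    rcases four x with rfl | rfl | rfl | rfl
    · linear_combination hn0
    · exact absurd rfl hx
    · linear_combination hq0
    · linear_combination hp0
  · -- `p = 0`, `t = 0`: MATCHING `{d,f} ⊔ {c,e}`, relation `m n = s q`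
    refine trdeg_le_five_of_matching (F := F) u v h2L hcd hce hcf hde hdf hef ht0 hp0 ?_ hu0 hcol2
    linear_combination hB0 + t * hp0
  · -- `s = 0`, `q = 0`: MATCHING `{c,f} ⊔ {d,e}`, relation `m n = p t`
    refine trdeg_le_five_of_matching (F := F) u v h2L hcd hcf hce hdf hde hef.symm hs0 hq0 ?_ hu0
      hcol2
    linear_combination hB0 + q * hs0
  · -- `s = t = 0`, then `n = 0`: STAR at `c`
    have hn0 : n = 0 := by
      have : m * n = 0 := by linear_combination hB0 + p * ht0 + q * hs0
      rcases mul_eq_zero.1 this with h | h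
      · exact absurd h hm
      · exact h
    refine trdeg_le_five_of_star (F := F) u v c (fun x hx => ?_) (hcol2 c)
    rcases four x with rfl | rfl | rfl | rfl
    · exact absurd rfl hx
    · linear_combination hn0
    · linear_combination ht0
    · linear_combination hs0

end Summit.ValiantsHypothesis.ValiantsHypothesis.Theorems.PolyaContinuedLaplaceRigidity.SingCodim

end
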